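import Literature.MathematicalPhysics.QuantumFieldTheory.Balaban1983to89.B12Eq439WilsonHessian
import Literature.MathematicalPhysics.QuantumFieldTheory.Balaban1983to89.B12Eq440TorusKernel

/-!
# `Balaban1983to89.B12Eq439PrintLetters` — [Balaban1987RG1] (4.39)–(4.40) p. 291 AT PRINT'S LETTERS: the Hessian of
the localized Wilson action at `𝐇 = 0` for `M_N(ℂ)`-valued (`𝔤`-valued) fields with `Re tr` normalized, its colour
reduction, and its passage to the `Δ_j` OF RECORD of [10] (1.65)/(1.66) on the torus — PROVED

HONEST FRAMING (cell `lit-balaban`, verbatim): statement-level skeleton of published theorems with citation tags;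
proofs where landed; nothing here is a claim about the Yang–Mills mass gap.

CITATION HEADER.  T. Bałaban, *Renormalization group approach to lattice gauge field theories. I. Generation of
effective actions in a small field approximation and a coupling constant renormalization in four dimensions*,
Commun. Math. Phys. **109** (1987) 249–301, doi:10.1007/bf01215223 [Balaban1987RG1] (cell paper B12 = «[I]»; held
text `paper:balaban1987-cmp109-rg-i-small-field`, journal page = PDF page + 248; p. 291 READ AS AN IMAGE from the
render `b2b-balaban-ref1/pages/1987-cmp109-rg-I-small-field/1987-cmp109-rg-I-small-field-p043-x2.png` by this seat,
2026-08-23).  [10] = T. Bałaban, *Propagators and renormalization transformations for lattice gauge theories. I*,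
Commun. Math. Phys. **95** (1984) 17–40 [Balaban1984PropagatorsI] (cell paper B5), (1.3) p. 18, (1.65)–(1.66) p. 29 —
used ONLY through the tree modules named below.  Unit `lit-balaban-r09` gen 43 (reader/typer of B12, display owner
of SKELETON row `B12.Eq4.38-4.40`; fold owner r20); HOME `run/shared/lean/pub/lit-balaban/`.

WHAT IS PRINTED (p. 291 [PDF 43], verbatim).  *«There is the second term under the sum over j, the term
  β_j(g_{j−1})(A(U_j(exp iB′V^{(k)})) − A(U_k(V^{(k)}))).   (4.38)
We localize it by the partition of unity connected with the partition π_j, and we apply to it the whole procedure of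
these two sections. As a result we obtain all the well controlled terms, and the terms in (4.34) with the function
𝐄^{(2)} replaced by the corresponding function calculated for the expression (4.38). By (4.35) it is equal to
  β_j(g_{j−1})⟨(δ²/δ𝐇²) Σ_{x,μ<ν} ζ_□′(x)[1 − Re tr(∂ exp iξ𝐇)(p_μν(x))]|_{𝐇=0}, H_j(□₀), H_j(□₀)⟩
    = β_j(g_{j−1})⟨∂^ξH_j(□₀), ζ_□′∂^ξH_j(□₀)⟩,  □′ ∈ π_j.   (4.39)
Replacing the functions H_j(□₀) by H_j and summing over all □′ in ξZ⁴ yields the following expression, as the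
expression corresponding to (4.37)
  β_j(g_{j−1})⟨∂^ξH_j, ∂^ξH_j⟩ = β_j(g_{j−1})Δ_j,   (4.40)
where Δ_j is given by the explicit formula (1.66) [10].»*  Conventions printed elsewhere in the series and used here:
the Wilson action `A(U) = Σ_p ξ^{d−4}[1 − Re tr U(∂p)]` with the NORMALIZED trace ((0.2) p. 252; [Balaban1985Background
Propagators] p. 392 «⟨X, Y⟩ = tr XY», «the trace is normalized»); `U = exp iξ𝐇` with `𝐇` Hermitian `𝔤`-valued;
p. 289 «τ_a are generators of the algebra 𝐠 … With our assumptions on the group G the identity (4.33) holds for 𝐄 if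
and only if 𝐄_{ab} is proportional to the identity matrix, 𝐄_{ab} = 𝐄δ_{ab}, and then ⟨𝐄, A⊗B⟩ = 𝐄 tr AB» (colour-diagonal
forms); [10] (1.65) p. 29 «The action Δ_k is
thus defined by ⟨B, Δ_kB⟩ = ⟨∂H_kB, ∂H_kB⟩».

WHAT THE TREE ALREADY HOLDS (used BY NAME, nothing restated).  `B12Eq439WilsonHessian` (this seat, gen 4, p246242):
(4.38) typed `term438`; (4.39) PROVED as `eq439` for EVERY continuous linear tracial `τ` on EVERY complete normed
`ℂ`-algebra `𝔸` — with the explicit NOT-HERE «the instantiation 𝔸 = M_N(ℂ), τ = N⁻¹Re tr … not spelled out because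
Mathlib's two real-module structures on complex matrices are not definitionally equal»; «summing over all □′»
`curlPairing_partition`.  `B12Eq440TorusKernel` (p10 gen 9, p308263): (4.40) ON THE TORUS — `eq440_torus`,
`inner_DeltaK_eq_sum` for the (1.19)/(1.65) operator of record `B5Eq114Gauss.DeltaK`; `B5Eq165DeltaK.eq165`
(p16): `⟨B, Δ_kB⟩ = 2·S^η(H_kB)` for every Landau minimiser `H_kB ∈ landauMin`.

WHAT THIS FILE ADDS (kernel-checked; 0 `sorry`; no named `Prop` fact; the `def`s are objects with bodies).
* §1 PRINT'S LETTER FUNCTIONAL: `rntrCLM N` = `N⁻¹ Re tr` on `M_N(ℂ)` as a CONTINUOUS real-linear functional for the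
  restriction-of-scalars real structure (the file-local convention of `B12GaugeFixExpansion25`: `Module.complexToReal`,
  L²-operator norm `Matrix.Norms.L2Operator`) — `rntrCLM_apply`, agreement with `Beta.PlaquetteVertex.rntr`
  (`rntrCLM_eq_rntr`), tracial (`rntrCLM_comm`), normalized (`rntrCLM_one`: `τ 1 = 1`).  This is the missing
  instantiation: with it `eq439` applies to print's algebra verbatim.
* §2 **(4.39) AT PRINT'S LETTERS** `eq439_matrix`: for `M_N(ℂ)`-valued bond fields `𝐇` on any lattice `(Λ, e)`, any
  weight `ζ` («ζ_□′»), any finite plaquette set («x, μ < ν»), `ξ ≠ 0`: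
  `(d/ds)²|₀ Σ_π w ζ(x_π)[1 − N⁻¹Re tr(∂ exp isξ𝐇)(π)] = Σ_π (wξ⁴) ζ(x_π) N⁻¹Re tr((∂^ξ𝐇)(π)²)` = `curlPairing`; one
  plaquette `eq439_plaq_matrix`; `𝔤`-valued fields for any real subspace `𝔤 ≤ M_N(ℂ)` (`eq439_lie`); the factor
  `β_j(g_{j−1})` on both members (`eq439_matrix_beta`); the two `H_j(□₀)` SLOTS — (4.39) as an identity of functions of
  `B` through any map `B ↦ H_j(□₀)B` (`eq439_slots`); «summing over all □′» at print's letters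
  (`eq439_matrix_partition`); `d = 4` weights (`eq439_matrix_dim4`: action weight `ξ^{d−4} = 1`, pairing weight `ξ⁴`).
* §3 COLOUR REDUCTION («E_{ab} = Eδ_{ab}»): for a trace-orthonormal Hermitian generator family `t`
  (`ColourTrace.TrOrthonormal`: `tr t_at_b = Nδ_{ab}`) and real components `𝐇 = Σ_a H^a t_a`:
  `⟨∂^ξ𝐇, ζ∂^ξ𝐇⟩_{N⁻¹Re tr} = Σ_a ⟨∂^ξH^a, ζ∂^ξH^a⟩` (`curlPairing_colour`), the scalar pairing being
  `curlPairingScalar wd ζ e ξ h S = Σ_π wd ζ(x_π) ((∂^ξh)(π))²` (`lcurl_colour`, `rntrCLM_sum_mul_sum`).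
* §4 THE SCALAR PAIRING ON THE TORUS OF [10] IS `2·S^η`: on level `k` of the tower `towerM L M k` (periods `L^kM_μ`,
  `η = L^{−k}`), with unit weight, all plaquettes `μ < ν` and Riemann weight `η^d`,
  `⟨∂^ηA, ∂^ηA⟩ = 2·actionEta L M k A` (`curlPairingScalar_torus_eq_two_mul_actionEta`) — the tree's (1.3)/(1.17)
  action `B5SectBStatements.actionEta` (= `B5Action121.actionS`), field strength `B5Action121.Fs`.
* §5 **(4.40) AT PRINT'S OBJECTS**: for every Landau minimiser `A ∈ B5Eq165DeltaK.landauMin L M k B` (= `H_kB`),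
  `⟨∂^ηH_kB, ∂^ηH_kB⟩ = ⟨B, Δ_kB⟩` (`eq440_scalar`, by §4 + `eq165`) `= Σ_{x,μ,y,ν} B(x,μ)K_{νμ}(x−y)B(y,ν)`
  (`eq440_scalar_kernel`, by `eq440_torus`); colour by colour for `𝐇 = Σ_a (H_kB^a) t_a`:
  `⟨∂^η𝐇, ∂^η𝐇⟩_{N⁻¹Re tr} = Σ_a ⟨B^a, Δ_kB^a⟩` (`eq440_colour`); and the whole chain from the Hessian of (4.39) with
  `ζ ≡ 1`: `(d/ds)²|₀ Σ_π w[1 − N⁻¹Re tr(∂ exp isη𝐇)(π)] = Σ_a ⟨B^a, Δ_kB^a⟩` whenever `wη⁴ = η^d` (`d = 4`: `w = 1`)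
  (`hessian_eq_sum_inner_DeltaK`, `hessian_eq_sum_inner_DeltaK_dim4`).

NOT CLAIMED.  The p. 291 sentence «we apply to it the whole procedure of these two sections. As a result we obtain
all the well controlled terms» (the §§3–4 localization/resummation machinery and its bounds — rows `B12.Eq4.34`,
`B12.Eq4.35-4.37`, and the irrelevant-term bounds (0.29)/Theorem 1) is NOT formalized here; nor the p. 290 replacement
`H_j(□₀) → H_j` with its error factor `B₀exp(−δ₀M(L^jη)⁻¹)` (row `B12.Eq4.35-4.37`, `B12HjFree290`); nor (4.41) (row
`B12.Eq4.41`).  §§4–5 are at `U = 1` on the torus of [10] (real Abelian components, every `d`, `L ≥ 1`, every period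
vector, every `k`), exactly the setting in which print invokes «(1.66) [10]»; the identification of print's
`H_j(□₀)`/`H_j` with `landauMin` is [10]'s definition («a configuration A minimizing ½⟨∂A, ∂A⟩ under Q_kA = B,
R∂*A = 0», `B5Eq165DeltaK`), not re-derived.  Value = print's own instance of (4.39) identified by kernel theorems
and joined to the (4.40) operator of record; NOT summit progress.
-/

open scoped Matrix.Norms.L2Operator BigOperators InnerProductSpace

noncomputable section

namespace Literature.MathematicalPhysics.QuantumFieldTheory.Balaban1983to89.B12Eq439PrintLetters

open B12Eq439WilsonHessian (wilsonLocExp curlPairing xiCurl xiCurl_apply eq439 eq439_plaq plaqHolExp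
  wilsonLocExp_zero curlPairing_partition)
open Beta.PlaquetteVertex (lcurl rntr rntr_apply)
open Beta.ColourTrace (TrOrthonormal)

/-! ## §1. Print's letter functional `N⁻¹ Re tr` on `M_N(ℂ)` as a continuous real-linear tracial functional -/

section Letters

variable {N : ℕ}

/-- File-local convention (as in `B12GaugeFixExpansion25`): the real vector-space structure of `M_N(ℂ)` is the
restriction of scalars of the complex one — the structure under which `B12Eq439WilsonHessian.eq439` (stated for
complete normed `ℂ`-algebras) reads `M_N(ℂ)`. [folklore] -/
local instance (priority := high) instModuleRealMat : Module ℝ (Matrix (Fin N) (Fin N) ℂ) :=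
  Module.complexToReal (Matrix (Fin N) (Fin N) ℂ)

/-- File-local convention: the real normed-space structure of `M_N(ℂ)` (L²-operator norm, restriction of scalars).
[folklore] -/
local instance (priority := high) instNormedSpaceRealMat : NormedSpace ℝ (Matrix (Fin N) (Fin N) ℂ) :=
  NormedSpace.complexToReal

/-- `Re ∘ tr` as a real-linear map for the restriction-of-scalars structure. [folklore] -/
def reTrL (N : ℕ) : Matrix (Fin N) (Fin N) ℂ →ₗ[ℝ] ℝ :=
  Complex.reLm.comp ((Matrix.traceLinearMap (Fin N) ℂ ℂ).restrictScalars ℝ)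

/-- **PRINT'S «Re tr», NORMALIZED** («the trace is normalized, i.e., tr 1 = 1»): `τ = N⁻¹ Re tr` on `M_N(ℂ)` as a
CONTINUOUS real-linear functional — the `τ` at which `B12Eq439WilsonHessian.eq439` is print's (4.39).
[cite: Balaban1987RG1, (0.2) p.252, (4.39) p.291] -/
def rntrCLM (N : ℕ) : Matrix (Fin N) (Fin N) ℂ →L[ℝ] ℝ :=
  (N : ℝ)⁻¹ • LinearMap.toContinuousLinearMap (reTrL N)

/-- unfolding: `τ(X) = N⁻¹ Re tr X`. [cite: Balaban1987RG1, (0.2) p.252] -/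
theorem rntrCLM_apply (X : Matrix (Fin N) (Fin N) ℂ) : rntrCLM N X = (N : ℝ)⁻¹ * (Matrix.trace X).re := by
  simp [rntrCLM, reTrL]

/-- `rntrCLM` IS the tree's letter functional `Beta.PlaquetteVertex.rntr` — print's normalized «Re tr» of the Wilson
action (0.2) (pointwise; the two differ only in the real-module structure they are registered against).
[cite: Balaban1987RG1, (0.2) p.252] -/
theorem rntrCLM_eq_rntr (X : Matrix (Fin N) (Fin N) ℂ) : rntrCLM N X = rntr X := by
  rw [rntrCLM_apply, rntr_apply]

/-- `τ` is tracial: `τ(XY) = τ(YX)` — the property of «Re tr» under which the Hessian (4.39) is the curl form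
(`B12Eq439WilsonHessian.eq439`'s hypothesis). [cite: Balaban1987RG1, (4.39) p.291] -/
theorem rntrCLM_comm (X Y : Matrix (Fin N) (Fin N) ℂ) : rntrCLM N (X * Y) = rntrCLM N (Y * X) := by
  rw [rntrCLM_apply, rntrCLM_apply, Matrix.trace_mul_comm]

/-- `τ` is normalized: `τ(1) = 1` («tr 1 = 1»). [cite: Balaban1987RG1, (0.2) p.252] -/
theorem rntrCLM_one [NeZero N] : rntrCLM N 1 = 1 := by
  rw [rntrCLM_apply, Matrix.trace_one, Fintype.card_fin]
  simp [NeZero.ne N]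

/-! ## §2. (4.39) at print's letters -/

variable {Λ : Type*} [AddCommGroup Λ] {D : Type*}

/-- **(4.39) AT PRINT'S LETTERS** — *«⟨(δ²/δ𝐇²) Σ_{x,μ<ν} ζ_□′(x)[1 − Re tr(∂ exp iξ𝐇)(p_μν(x))]|_{𝐇=0}, H_j(□₀),
H_j(□₀)⟩ = ⟨∂^ξH_j(□₀), ζ_□′∂^ξH_j(□₀)⟩»*: for `M_N(ℂ)`-valued bond fields `𝐇` (print: Hermitian `𝔤`-valued,
`𝔤 ⊂ M_N(ℂ)`), `Re tr` normalized, on every lattice `(Λ, e)`, every weight `ζ`, action weight `w` (= `ξ^{d−4}`),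
`ξ ≠ 0`, every finite plaquette set `S`: the second derivative at `s = 0` of
`s ↦ Σ_{π∈S} w ζ(x_π)[1 − N⁻¹Re tr(∂ exp isξ𝐇)(π)]` is `Σ_{π∈S} (wξ⁴) ζ(x_π) N⁻¹Re tr((∂^ξ𝐇)(π)²)` — the own gen-4
`eq439` instantiated (its NOT-HERE (1) closed). [cite: Balaban1987RG1, (4.39) p.291] -/
theorem eq439_matrix (w : ℝ) (ζ : Λ → ℝ) (e : D → Λ) {ξ : ℝ} (hξ : ξ ≠ 0)
    (H : Λ → D → Matrix (Fin N) (Fin N) ℂ) (S : Finset (Λ × D × D)) :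
    deriv (deriv (wilsonLocExp (rntrCLM N) w ζ e (((ξ : ℂ) * Complex.I) • H) S)) 0
      = curlPairing (rntrCLM N) (w * ξ ^ 4) ζ e ξ H S :=
  eq439 (rntrCLM N) rntrCLM_comm w ζ e hξ H S

/-- (4.39) at print's letters, one plaquette: `(d/ds)²|₀ [1 − N⁻¹Re tr(∂ exp isξ𝐇)(p_μν(x))] =
ξ²·N⁻¹Re tr((curl 𝐇)_μν(x)²)`. [cite: Balaban1987RG1, (4.39) p.291] -/
theorem eq439_plaq_matrix (e : D → Λ) (ξ : ℝ) (H : Λ → D → Matrix (Fin N) (Fin N) ℂ) (x : Λ) (μ ν : D) :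
    deriv (deriv (fun t : ℝ => 1 - rntrCLM N (plaqHolExp e (((ξ : ℂ) * Complex.I) • H) x μ ν t))) 0
      = ξ ^ 2 * rntrCLM N (lcurl e H x μ ν * lcurl e H x μ ν) :=
  eq439_plaq (rntrCLM N) rntrCLM_comm e ξ H x μ ν

/-- at `s = 0` (`U = 1`) the localized action vanishes — `τ(1) = 1` is print's normalization.
[cite: Balaban1987RG1, (0.2) p.252, (4.39) p.291] -/
theorem wilsonLocExp_matrix_zero [NeZero N] (w : ℝ) (ζ : Λ → ℝ) (e : D → Λ)
    (a : Λ → D → Matrix (Fin N) (Fin N) ℂ) (S : Finset (Λ × D × D)) :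
    wilsonLocExp (rntrCLM N) w ζ e a S 0 = 0 :=
  wilsonLocExp_zero (rntrCLM N) rntrCLM_one w ζ e a S

/-- (4.39) for `𝔤`-VALUED fields, `𝔤` any real subspace of `M_N(ℂ)` (print: the Lie algebra of `G ⊂ U(N)`; values in a
subspace are values in `M_N(ℂ)`). [cite: Balaban1987RG1, (4.39) p.291] -/
theorem eq439_lie (𝔤 : Submodule ℝ (Matrix (Fin N) (Fin N) ℂ)) (w : ℝ) (ζ : Λ → ℝ) (e : D → Λ) {ξ : ℝ}
    (hξ : ξ ≠ 0) (H : Λ → D → 𝔤) (S : Finset (Λ × D × D)) :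
    deriv (deriv (wilsonLocExp (rntrCLM N) w ζ e
        (((ξ : ℂ) * Complex.I) • fun x μ => (H x μ : Matrix (Fin N) (Fin N) ℂ)) S)) 0
      = curlPairing (rntrCLM N) (w * ξ ^ 4) ζ e ξ (fun x μ => (H x μ : Matrix (Fin N) (Fin N) ℂ)) S :=
  eq439_matrix w ζ e hξ _ S

/-- (4.39) with the printed factor `β_j(g_{j−1})` on both members. [cite: Balaban1987RG1, (4.38) p.291, (4.39) p.291] -/
theorem eq439_matrix_beta (β w : ℝ) (ζ : Λ → ℝ) (e : D → Λ) {ξ : ℝ} (hξ : ξ ≠ 0)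
    (H : Λ → D → Matrix (Fin N) (Fin N) ℂ) (S : Finset (Λ × D × D)) :
    β * deriv (deriv (wilsonLocExp (rntrCLM N) w ζ e (((ξ : ℂ) * Complex.I) • H) S)) 0
      = β * curlPairing (rntrCLM N) (w * ξ ^ 4) ζ e ξ H S := by
  rw [eq439_matrix w ζ e hξ H S]

/-- **THE TWO `H_j(□₀)` SLOTS**: (4.39) is printed with `H_j(□₀)` in both arguments of the Hessian, i.e. as an identity
of (quadratic) functions of the block field `B` through the map `B ↦ H_j(□₀)B`; for ANY map `Hj` (print: the
functions `H_j(□₀)` of (4.35), p. 290) the two functions of `B` coincide. [cite: Balaban1987RG1, (4.39) p.291] -/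
theorem eq439_slots {𝓑 : Type*} (Hj : 𝓑 → Λ → D → Matrix (Fin N) (Fin N) ℂ) (w : ℝ) (ζ : Λ → ℝ) (e : D → Λ)
    {ξ : ℝ} (hξ : ξ ≠ 0) (S : Finset (Λ × D × D)) :
    (fun B => deriv (deriv (wilsonLocExp (rntrCLM N) w ζ e (((ξ : ℂ) * Complex.I) • Hj B) S)) 0)
      = fun B => curlPairing (rntrCLM N) (w * ξ ^ 4) ζ e ξ (Hj B) S :=
  funext fun B => eq439_matrix w ζ e hξ (Hj B) S

/-- *«summing over all □′ … yields ⟨∂^ξH_j, ∂^ξH_j⟩»* at print's letters: if the weights `ζ_□′` are a partition of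
unity on the plaquettes of `S`, the sum over `□′` of the localized Hessians (4.39) is the unweighted pairing
`⟨∂^ξ𝐇, ∂^ξ𝐇⟩`. [cite: Balaban1987RG1, (4.40) p.291] -/
theorem eq439_matrix_partition {ι : Type*} (I : Finset ι) (w : ℝ) (ζ : ι → Λ → ℝ) (e : D → Λ) {ξ : ℝ}
    (hξ : ξ ≠ 0) (H : Λ → D → Matrix (Fin N) (Fin N) ℂ) (S : Finset (Λ × D × D))
    (hpart : ∀ π ∈ S, ∑ i ∈ I, ζ i π.1 = 1) :
    ∑ i ∈ I, deriv (deriv (wilsonLocExp (rntrCLM N) w (ζ i) e (((ξ : ℂ) * Complex.I) • H) S)) 0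
      = curlPairing (rntrCLM N) (w * ξ ^ 4) (fun _ => 1) e ξ H S := by
  simp_rw [eq439_matrix w _ e hξ H S]
  exact curlPairing_partition I (rntrCLM N) (w * ξ ^ 4) ζ e ξ H S hpart

/-- (4.39) at print's dimension `d = 4` («□′ in ξZ⁴»): the action weight `ξ^{d−4}` is `1` and the pairing weight is the
Riemann weight `ξ⁴ = ξ^d`. [cite: Balaban1987RG1, (4.39) p.291] -/
theorem eq439_matrix_dim4 (ζ : Λ → ℝ) (e : D → Λ) {ξ : ℝ} (hξ : ξ ≠ 0) (H : Λ → D → Matrix (Fin N) (Fin N) ℂ)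
    (S : Finset (Λ × D × D)) :
    deriv (deriv (wilsonLocExp (rntrCLM N) 1 ζ e (((ξ : ℂ) * Complex.I) • H) S)) 0
      = curlPairing (rntrCLM N) (ξ ^ 4) ζ e ξ H S := by
  simpa only [one_mul] using eq439_matrix 1 ζ e hξ H S

/-! ## §3. Colour reduction: `⟨∂^ξ𝐇, ζ∂^ξ𝐇⟩_{N⁻¹Re tr} = Σ_a ⟨∂^ξH^a, ζ∂^ξH^a⟩` -/

/-- THE SCALAR (one-colour, real) localized curl pairing `⟨∂^ξh, ζ∂^ξh⟩ = Σ_{π∈S} wd·ζ(x_π)·((∂^ξh)(π))²`,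
`∂^ξh = ξ⁻¹·curl h` — the real-component form of `B12Eq439WilsonHessian.curlPairing`.
[cite: Balaban1987RG1, (4.39) p.291] -/
def curlPairingScalar (wd : ℝ) (ζ : Λ → ℝ) (e : D → Λ) (ξ : ℝ) (h : Λ → D → ℝ) (S : Finset (Λ × D × D)) : ℝ :=
  ∑ π ∈ S, wd * ζ π.1 * (ξ⁻¹ * lcurl e h π.1 π.2.1 π.2.2) ^ 2

/-- unfolding of the scalar pairing. [cite: Balaban1987RG1, (4.39) p.291] -/
theorem curlPairingScalar_apply (wd : ℝ) (ζ : Λ → ℝ) (e : D → Λ) (ξ : ℝ) (h : Λ → D → ℝ)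
    (S : Finset (Λ × D × D)) :
    curlPairingScalar wd ζ e ξ h S = ∑ π ∈ S, wd * ζ π.1 * (ξ⁻¹ * lcurl e h π.1 π.2.1 π.2.2) ^ 2 := rfl

/-- the scalar pairing `⟨∂^ξh, ζ∂^ξh⟩` is nonnegative for nonnegative weights `ζ_□′ ≥ 0` (a sum of squares).
[cite: Balaban1987RG1, (4.39) p.291] -/
theorem curlPairingScalar_nonneg {wd : ℝ} (hwd : 0 ≤ wd) {ζ : Λ → ℝ} (hζ : ∀ x, 0 ≤ ζ x) (e : D → Λ) (ξ : ℝ)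
    (h : Λ → D → ℝ) (S : Finset (Λ × D × D)) : 0 ≤ curlPairingScalar wd ζ e ξ h S :=
  Finset.sum_nonneg fun _ _ => mul_nonneg (mul_nonneg hwd (hζ _)) (sq_nonneg _)

variable {C : Type*} [Fintype C] [DecidableEq C]

omit [AddCommGroup Λ] [DecidableEq C] in
/-- A `𝔤`-valued field from real colour components: `𝐇(x,μ) = Σ_a H^a(x,μ) t_a` («A = Σ_a A^a τ_a»).
[cite: Balaban1987RG1, (4.33) p.289] -/
def colourField (t : C → Matrix (Fin N) (Fin N) ℂ) (Hc : C → Λ → D → ℝ) : Λ → D → Matrix (Fin N) (Fin N) ℂ :=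
  fun x μ => ∑ a, ((Hc a x μ : ℝ) : ℂ) • t a

omit [AddCommGroup Λ] [DecidableEq C] in
/-- unfolding of `colourField`. [cite: Balaban1987RG1, (4.33) p.289] -/
theorem colourField_apply (t : C → Matrix (Fin N) (Fin N) ℂ) (Hc : C → Λ → D → ℝ) (x : Λ) (μ : D) :
    colourField t Hc x μ = ∑ a, ((Hc a x μ : ℝ) : ℂ) • t a := rfl

omit [DecidableEq C] in
/-- the curl acts componentwise in the generator basis («components in the basis {τ_a}»):
`(curl 𝐇)(π) = Σ_a (curl H^a)(π) t_a`. [cite: Balaban1987RG1, (4.33) p.289] -/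
theorem lcurl_colour (t : C → Matrix (Fin N) (Fin N) ℂ) (Hc : C → Λ → D → ℝ) (e : D → Λ) (x : Λ) (μ ν : D) :
    lcurl e (colourField t Hc) x μ ν = ∑ a, ((lcurl e (Hc a) x μ ν : ℝ) : ℂ) • t a := by
  simp only [lcurl, colourField_apply, ← Finset.sum_sub_distrib, ← sub_smul]
  refine Finset.sum_congr rfl fun a _ => ?_
  norm_cast

omit [DecidableEq C] in
/-- `∂^ξ` acts componentwise in the generator basis: `(∂^ξ𝐇)(π) = Σ_a (ξ⁻¹(curl H^a)(π)) t_a`.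
[cite: Balaban1987RG1, (4.33) p.289] -/
theorem xiCurl_colour (t : C → Matrix (Fin N) (Fin N) ℂ) (Hc : C → Λ → D → ℝ) (e : D → Λ) (ξ : ℝ) (x : Λ)
    (μ ν : D) :
    xiCurl ξ e (colourField t Hc) x μ ν = ∑ a, ((ξ⁻¹ * lcurl e (Hc a) x μ ν : ℝ) : ℂ) • t a := by
  have h1 : xiCurl ξ e (colourField t Hc) x μ ν = ((ξ⁻¹ : ℝ) : ℂ) • lcurl e (colourField t Hc) x μ ν := by
    rw [xiCurl_apply]; rfl
  rw [h1, lcurl_colour, Finset.smul_sum]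
  simp_rw [smul_smul, ← Complex.ofReal_mul]

/-- the letter functional on a product of two colour expansions: for a family `t` with `tr(t_at_b) = sNδ_{ab}`
(`s = 1`: trace-orthonormal Hermitian generators; `s = −1`: the anti-Hermitian letters `it_a`),
`N⁻¹Re tr((Σ_a c_a t_a)(Σ_b c′_b t_b)) = s·Σ_a c_a c′_a` — p. 289 «⟨𝐄, A⊗B⟩ = 𝐄 tr AB» for the unit form in
components. [cite: Balaban1987RG1, (4.33) p.289] -/
theorem rntrCLM_sum_mul_sum [NeZero N] {t : C → Matrix (Fin N) (Fin N) ℂ} {s : ℝ}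
    (ht : ∀ a b, (t a * t b).trace = if a = b then ((s * N : ℝ) : ℂ) else 0) (c c' : C → ℝ) :
    rntrCLM N ((∑ a, ((c a : ℝ) : ℂ) • t a) * ∑ b, ((c' b : ℝ) : ℂ) • t b) = s * ∑ a, c a * c' a := by
  rw [rntrCLM_apply, Finset.sum_mul]
  simp_rw [Finset.mul_sum, smul_mul_smul_comm, Matrix.trace_sum, Matrix.trace_smul, smul_eq_mul, ht, mul_ite,
    mul_zero, Finset.sum_ite_eq, Finset.mem_univ, if_true]
  rw [Complex.re_sum, Finset.mul_sum]
  refine Finset.sum_congr rfl fun a _ => ?_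
  have hN : (N : ℝ) ≠ 0 := Nat.cast_ne_zero.mpr (NeZero.ne N)
  simp only [← Complex.ofReal_mul, Complex.ofReal_re]
  field_simp

/-- for a TRACE-ORTHONORMAL family (`ColourTrace.TrOrthonormal t`: `tr(t_at_b) = Nδ_{ab}`) the letter functional of a
product of colour expansions is the Euclidean product of the components («𝐄_{ab} = 𝐄δ_{ab} … ⟨𝐄, A⊗B⟩ = 𝐄 tr AB»
with `𝐄 = 1`). [cite: Balaban1987RG1, (4.33) p.289] -/
theorem rntrCLM_sum_mul_sum_of_trOrthonormal [NeZero N] {t : C → Matrix (Fin N) (Fin N) ℂ}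
    (ht : TrOrthonormal t) (c c' : C → ℝ) :
    rntrCLM N ((∑ a, ((c a : ℝ) : ℂ) • t a) * ∑ b, ((c' b : ℝ) : ℂ) • t b) = ∑ a, c a * c' a := by
  have h := rntrCLM_sum_mul_sum (N := N) (t := t) (s := 1) (fun a b => by
    rw [ht a b]; congr 1; simp) c c'
  rw [h, one_mul]

/-- **COLOUR REDUCTION OF THE PAIRING** (the «E_{ab} = Eδ_{ab}» shape of p. 289): for a family `t` with
`tr(t_at_b) = sNδ_{ab}` and real components `𝐇 = Σ_a H^a t_a`,
`⟨∂^ξ𝐇, ζ∂^ξ𝐇⟩_{N⁻¹Re tr} = s·Σ_a ⟨∂^ξH^a, ζ∂^ξH^a⟩`. [cite: Balaban1987RG1, (4.33) p.289, (4.39) p.291] -/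
theorem curlPairing_colour_sign [NeZero N] {t : C → Matrix (Fin N) (Fin N) ℂ} {s : ℝ}
    (ht : ∀ a b, (t a * t b).trace = if a = b then ((s * N : ℝ) : ℂ) else 0) (Hc : C → Λ → D → ℝ) (wd : ℝ)
    (ζ : Λ → ℝ) (e : D → Λ) (ξ : ℝ) (S : Finset (Λ × D × D)) :
    curlPairing (rntrCLM N) wd ζ e ξ (colourField t Hc) S = s * ∑ a, curlPairingScalar wd ζ e ξ (Hc a) S := by
  simp only [curlPairing, curlPairingScalar, xiCurl_colour, rntrCLM_sum_mul_sum ht]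
  simp_rw [Finset.mul_sum]
  rw [Finset.sum_comm]
  refine Finset.sum_congr rfl fun a _ => Finset.sum_congr rfl fun π _ => ?_
  ring

/-- **COLOUR REDUCTION, PRINT'S CASE** (Hermitian trace-orthonormal generators `t_a`, `N⁻¹tr(t_at_b) = δ_{ab}`; `𝐇 =
Σ_a H^a t_a` Hermitian `𝔤`-valued): `⟨∂^ξ𝐇, ζ∂^ξ𝐇⟩_{N⁻¹Re tr} = Σ_a ⟨∂^ξH^a, ζ∂^ξH^a⟩` — the (4.39) form is
colour-diagonal, each colour carrying the same scalar form. [cite: Balaban1987RG1, (4.33) p.289, (4.39) p.291] -/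
theorem curlPairing_colour [NeZero N] {t : C → Matrix (Fin N) (Fin N) ℂ} (ht : TrOrthonormal t)
    (Hc : C → Λ → D → ℝ) (wd : ℝ) (ζ : Λ → ℝ) (e : D → Λ) (ξ : ℝ) (S : Finset (Λ × D × D)) :
    curlPairing (rntrCLM N) wd ζ e ξ (colourField t Hc) S = ∑ a, curlPairingScalar wd ζ e ξ (Hc a) S := by
  have h := curlPairing_colour_sign (N := N) (t := t) (s := 1) (fun a b => by
    rw [ht a b]; congr 1; simp) Hc wd ζ e ξ S
  rw [h, one_mul]

/-- (4.39) at print's letters, colour by colour: for Hermitian trace-orthonormal generators and `𝐇 = Σ_a H^a t_a`,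
the Hessian of the localized Wilson action at `𝐇 = 0` is `Σ_a ⟨∂^ξH^a, ζ∂^ξH^a⟩`.
[cite: Balaban1987RG1, (4.39) p.291] -/
theorem eq439_colour [NeZero N] {t : C → Matrix (Fin N) (Fin N) ℂ} (ht : TrOrthonormal t)
    (Hc : C → Λ → D → ℝ) (w : ℝ) (ζ : Λ → ℝ) (e : D → Λ) {ξ : ℝ} (hξ : ξ ≠ 0) (S : Finset (Λ × D × D)) :
    deriv (deriv (wilsonLocExp (rntrCLM N) w ζ e (((ξ : ℂ) * Complex.I) • colourField t Hc) S)) 0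
      = ∑ a, curlPairingScalar (w * ξ ^ 4) ζ e ξ (Hc a) S := by
  rw [eq439_matrix w ζ e hξ _ S, curlPairing_colour ht]

end Letters

/-! ## §4. The scalar pairing on the torus of [10] is `2·S^η` -/

section Torus

open B5Prop11Plancherel (Tor unitVec)
open B5SectBStatements (Fld towerM eta actionEta cplx)
open B5Action121 (Fs Fs_apply actionS)

variable {d : ℕ} (L : ℕ) [NeZero L] (M : Fin d → ℕ) [hM : ∀ μ, NeZero (M μ)]

/-- PRINT'S PLAQUETTE SET on a torus: all `p_μν(x)`, `x ∈ T`, `μ < ν` («Σ_{x,μ<ν}»). [cite: Balaban1987RG1, (4.39) p.291] -/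
def plaquettes (Np : Fin d → ℕ) [∀ μ, NeZero (Np μ)] : Finset (Tor Np × Fin d × Fin d) :=
  Finset.univ.filter fun π => π.2.1 < π.2.2

/-- membership in the plaquette set. [cite: Balaban1987RG1, (4.39) p.291] -/
theorem mem_plaquettes (Np : Fin d → ℕ) [∀ μ, NeZero (Np μ)] (π : Tor Np × Fin d × Fin d) : π ∈ plaquettes Np ↔ π.2.1 < π.2.2 := by
  simp [plaquettes]

/-- a real vector field of [10] (`A(x,μ) = A_μ(x)`, `B5SectBStatements.Fld`) read as a bond field `x ↦ μ ↦ A_μ(x)`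
for the lattice-curl calculus of `Beta.PlaquetteVertex`. [cite: Balaban1984PropagatorsI, (1.1) p.18] -/
def bondFn {Np : Fin d → ℕ} (A : Fld Np) : Tor Np → Fin d → ℝ := fun x μ => A (x, μ)

/-- unfolding of `bondFn`. [cite: Balaban1984PropagatorsI, (1.1) p.18] -/
theorem bondFn_apply {Np : Fin d → ℕ} (A : Fld Np) (x : Tor Np) (μ : Fin d) : bondFn A x μ = A (x, μ) := rfl

/-- THE DICTIONARY curl ↔ field strength: on level `k` of the tower, `η⁻¹·(curl A)(p_μν(x))` along the unit frame is
the (1.2) field strength `F_μν(x)` of [10] with lattice factor `η⁻¹ = L^k` (`B5Action121.Fs` of the complexified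
field). [cite: Balaban1984PropagatorsI, (1.2) p.18] -/
theorem Fs_cplx_eq_xiCurl (k : ℕ) (A : Fld (towerM L M k)) (x : Tor (towerM L M k)) (μ ν : Fin d) :
    Fs (towerM L M k) ((L : ℂ) ^ k) (cplx A) μ ν x
      = (((eta L k)⁻¹ * lcurl (unitVec (towerM L M k)) (bondFn A) x μ ν : ℝ) : ℂ) := by
  rw [Fs_apply, eta, inv_inv]
  simp only [cplx, lcurl, bondFn_apply]
  push_cast
  ring

/-- … hence `|F_μν(x)|² = (η⁻¹(curl A)(p_μν(x)))²`. [cite: Balaban1984PropagatorsI, (1.3) p.18] -/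
theorem norm_Fs_cplx_sq (k : ℕ) (A : Fld (towerM L M k)) (x : Tor (towerM L M k)) (μ ν : Fin d) :
    ‖Fs (towerM L M k) ((L : ℂ) ^ k) (cplx A) μ ν x‖ ^ 2
      = ((eta L k)⁻¹ * lcurl (unitVec (towerM L M k)) (bondFn A) x μ ν) ^ 2 := by
  rw [Fs_cplx_eq_xiCurl, Complex.norm_real, Real.norm_eq_abs, sq_abs]

/-- **THE SCALAR PAIRING ON THE TORUS OF [10] IS `2·S^η`**: on level `k` of the tower (`η = L^{−k}`), with unit weight,
all plaquettes `μ < ν` and Riemann weight `η^d`, `⟨∂^ηA, ∂^ηA⟩ = Σ_{x,μ<ν} η^d(η⁻¹ curl A)² = 2·S^η(A)` for the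
(1.3)/(1.17) action `actionEta` («½ Σ_p ε^d|F(p)|²»), i.e. «⟨∂A, ∂A⟩» of (1.65) read through (1.21).
[cite: Balaban1984PropagatorsI, (1.3) p.18, (1.65) p.29] [cite: Balaban1987RG1, (4.40) p.291] -/
theorem curlPairingScalar_torus_eq_two_mul_actionEta (k : ℕ) (A : Fld (towerM L M k)) :
    curlPairingScalar ((eta L k) ^ d) (fun _ => 1) (unitVec (towerM L M k)) (eta L k) (bondFn A)
        (plaquettes (towerM L M k))
      = 2 * actionEta L M k A := by
  rw [actionEta, actionS, curlPairingScalar, plaquettes, Finset.sum_filter]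
  rw [← mul_assoc, show (2 : ℝ) * (1 / 2) = 1 by norm_num, one_mul]
  rw [Fintype.sum_prod_type]
  refine Finset.sum_congr rfl fun x _ => ?_
  rw [Fintype.sum_prod_type]
  refine Finset.sum_congr rfl fun μ _ => Finset.sum_congr rfl fun ν _ => ?_
  dsimp only
  split_ifs with hμν
  · rw [norm_Fs_cplx_sq, mul_one]
  · rfl

/-! ## §5. (4.40) at print's objects: `⟨∂^ηH_kB, ∂^ηH_kB⟩ = ⟨B, Δ_kB⟩`, colour by colour, and the whole chain -/

open B5Eq165DeltaK (landauMin eq165)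
open B5Eq114Gauss (DeltaK)
open B12Eq440TorusKernel (torKer eq440_torus)

/-- **(4.40) AT PRINT'S OBJECTS, ONE COLOUR** — *«β_j(g_{j−1})⟨∂^ξH_j, ∂^ξH_j⟩ = β_j(g_{j−1})Δ_j, where Δ_j is given by
the explicit formula (1.66) [10]»*: for every Landau minimiser `A = H_kB ∈ landauMin L M k B` of [10] («a
configuration A minimizing ½⟨∂A, ∂A⟩ under the conditions Q_kA = B, R∂*A = 0») the curl pairing of `H_kB` on level `k`
IS the quadratic form of the (1.19)/(1.65) operator `Δ_k` OF RECORD: `⟨∂^ηH_kB, ∂^ηH_kB⟩ = ⟨B, Δ_kB⟩` (§4 + p16's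
`eq165`). [cite: Balaban1987RG1, (4.40) p.291] [cite: Balaban1984PropagatorsI, (1.65) p.29] -/
theorem eq440_scalar (k : ℕ) {B : Fld M} {A : Fld (towerM L M k)} (hA : A ∈ landauMin L M k B) :
    curlPairingScalar ((eta L k) ^ d) (fun _ => 1) (unitVec (towerM L M k)) (eta L k) (bondFn A)
        (plaquettes (towerM L M k))
      = ⟪B, DeltaK L M k B⟫_ℝ := by
  rw [curlPairingScalar_torus_eq_two_mul_actionEta, eq165 L M k hA]

/-- (4.40) at print's objects, one colour, KERNEL FORM: `⟨∂^ηH_kB, ∂^ηH_kB⟩ = Σ_{x,μ}Σ_{y,ν} B(x,μ)K_{νμ}(x − y)B(y,ν)`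
with `K` the inverse DFT of the printed symbol (4.41) (p10's `eq440_torus`).
[cite: Balaban1987RG1, (4.40) p.291, (4.41) p.291] -/
theorem eq440_scalar_kernel (k : ℕ) {B : Fld M} {A : Fld (towerM L M k)} (hA : A ∈ landauMin L M k B) :
    curlPairingScalar ((eta L k) ^ d) (fun _ => 1) (unitVec (towerM L M k)) (eta L k) (bondFn A)
        (plaquettes (towerM L M k))
      = ∑ x, ∑ μ, ∑ y, ∑ ν, B (x, μ) * (torKer (L ^ k) M ν μ (x - y)).re * B (y, ν) := by
  rw [curlPairingScalar_torus_eq_two_mul_actionEta, eq440_torus L M k hA]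

variable {N : ℕ} {C : Type*} [Fintype C] [DecidableEq C]

/-- File-local convention (as in §1): restriction-of-scalars real structure on `M_N(ℂ)`. [folklore] -/
local instance (priority := high) instModuleRealMat' : Module ℝ (Matrix (Fin N) (Fin N) ℂ) :=
  Module.complexToReal (Matrix (Fin N) (Fin N) ℂ)

/-- File-local convention (as in §1): real normed-space structure on `M_N(ℂ)`. [folklore] -/
local instance (priority := high) instNormedSpaceRealMat' : NormedSpace ℝ (Matrix (Fin N) (Fin N) ℂ) :=
  NormedSpace.complexToReal

/-- **(4.40) AT PRINT'S OBJECTS, ALL COLOURS** («E_{ab} = Eδ_{ab}»): for Hermitian trace-orthonormal generators `t_a`,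
block fields `B^a` and their Landau minimisers `A^a = H_kB^a`, the `𝔤`-valued field `𝐇 = Σ_a (H_kB^a) t_a` has
`⟨∂^η𝐇, ∂^η𝐇⟩_{N⁻¹Re tr} = Σ_a ⟨B^a, Δ_kB^a⟩` — (4.40) with `Δ_j` acting diagonally in colour.
[cite: Balaban1987RG1, (4.40) p.291, (4.33) p.289] [cite: Balaban1984PropagatorsI, (1.65) p.29] -/
theorem eq440_colour [NeZero N] {t : C → Matrix (Fin N) (Fin N) ℂ} (ht : TrOrthonormal t) (k : ℕ)
    {Bc : C → Fld M} {Ac : C → Fld (towerM L M k)} (hA : ∀ a, Ac a ∈ landauMin L M k (Bc a)) :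
    curlPairing (rntrCLM N) ((eta L k) ^ d) (fun _ => 1) (unitVec (towerM L M k)) (eta L k)
        (colourField t fun a => bondFn (Ac a)) (plaquettes (towerM L M k))
      = ∑ a, ⟪Bc a, DeltaK L M k (Bc a)⟫_ℝ := by
  rw [curlPairing_colour ht]
  exact Finset.sum_congr rfl fun a _ => eq440_scalar L M k (hA a)

/-- `η = L^{−k} ≠ 0`. [cite: Balaban1984PropagatorsI, (1.18) p.20] -/
theorem eta_ne_zero (k : ℕ) : eta L k ≠ 0 := by
  rw [eta]
  exact inv_ne_zero (pow_ne_zero _ (Nat.cast_ne_zero.mpr (NeZero.ne L)))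

/-- **THE WHOLE CHAIN (4.39) ⟹ (4.40) AT PRINT'S OBJECTS**: the Hessian at `𝐇 = 0` of the (unlocalized, `ζ ≡ 1`) Wilson
action in exponential coordinates `Σ_{x,μ<ν} w[1 − N⁻¹Re tr(∂ exp iη𝐇)(p_μν(x))]` on level `k` of the torus of [10],
in the direction `𝐇 = Σ_a (H_kB^a) t_a` (Hermitian trace-orthonormal `t_a`, Landau minimisers `H_kB^a`), equals
`Σ_a ⟨B^a, Δ_kB^a⟩` — whenever the action weight satisfies `wη⁴ = η^d` (print: `d = 4`, `w = ξ^{d−4} = 1`).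
[cite: Balaban1987RG1, (4.39) p.291, (4.40) p.291] [cite: Balaban1984PropagatorsI, (1.65) p.29] -/
theorem hessian_eq_sum_inner_DeltaK [NeZero N] {t : C → Matrix (Fin N) (Fin N) ℂ}
    (ht : TrOrthonormal t) (k : ℕ) {w : ℝ} (hw : w * eta L k ^ 4 = eta L k ^ d) {Bc : C → Fld M}
    {Ac : C → Fld (towerM L M k)} (hA : ∀ a, Ac a ∈ landauMin L M k (Bc a)) :
    deriv (deriv (wilsonLocExp (rntrCLM N) w (fun _ => 1) (unitVec (towerM L M k))
        (((eta L k : ℂ) * Complex.I) • colourField t fun a => bondFn (Ac a)) (plaquettes (towerM L M k)))) 0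
      = ∑ a, ⟪Bc a, DeltaK L M k (Bc a)⟫_ℝ := by
  rw [eq439_matrix w _ _ (eta_ne_zero L k), hw, eq440_colour L M ht k hA]

/-- The chain at print's dimension `d = 4`, `w = 1`. [cite: Balaban1987RG1, (4.39) p.291, (4.40) p.291] -/
theorem hessian_eq_sum_inner_DeltaK_dim4 {M4 : Fin 4 → ℕ} [∀ μ, NeZero (M4 μ)] [NeZero N]
    {t : C → Matrix (Fin N) (Fin N) ℂ} (ht : TrOrthonormal t) (k : ℕ) {Bc : C → Fld M4}
    {Ac : C → Fld (towerM L M4 k)} (hA : ∀ a, Ac a ∈ landauMin L M4 k (Bc a)) :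
    deriv (deriv (wilsonLocExp (rntrCLM N) 1 (fun _ => 1) (unitVec (towerM L M4 k))
        (((eta L k : ℂ) * Complex.I) • colourField t fun a => bondFn (Ac a)) (plaquettes (towerM L M4 k)))) 0
      = ∑ a, ⟪Bc a, DeltaK L M4 k (Bc a)⟫_ℝ :=
  hessian_eq_sum_inner_DeltaK L M4 ht k (by rw [one_mul]) hA

end Torus

/-! ## §6 (v1.1, append-only). The letter functional IS the cell's normalized trace `UnitaryModel.nReTr`

DEFINITIONS-register item H39 (steward r20, `lit-balaban-r20` DEFINITIONS v1.58): print's normalized «Re tr» is typed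
in the cell ONCE, as `UnitaryModel.nReTr U = Re tr U / |n|` (the functional behind the `GaugeGroup.reTr` instances of the
`U(N)` / `SU(N)` models, F11); §1's `rntrCLM N` is the same function at `n = Fin N`, packaged as a continuous
real-linear map for `B12Eq439WilsonHessian.eq439`.  The bridge below records the identity so that no second «Re tr»
object lives in the tree unlinked (twin of `rntrCLM_eq_rntr` for `Beta.PlaquetteVertex.rntr`). -/

section Bridge

variable {N : ℕ}

/-- **H39 bridge**: `rntrCLM N X = UnitaryModel.nReTr X` — print's normalized «Re tr» («the trace is normalized, i.e.,
tr 1 = 1») typed once in the cell. [cite: Balaban1987RG1, (0.2) p.252] -/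
theorem rntrCLM_apply_eq_nReTr (X : Matrix (Fin N) (Fin N) ℂ) : rntrCLM N X = UnitaryModel.nReTr X := by
  rw [rntrCLM_apply, UnitaryModel.nReTr, Fintype.card_fin, div_eq_inv_mul]

/-- the same as an equality of functions `M_N(ℂ) → ℝ`. [cite: Balaban1987RG1, (0.2) p.252] -/
theorem coe_rntrCLM_eq_nReTr : ⇑(rntrCLM N) = (UnitaryModel.nReTr : Matrix (Fin N) (Fin N) ℂ → ℝ) :=
  funext rntrCLM_apply_eq_nReTr

/-- hence the tree's third name for the same number: `Beta.PlaquetteVertex.rntr X = UnitaryModel.nReTr X`.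
[cite: Balaban1987RG1, (0.2) p.252] -/
theorem rntr_eq_nReTr (X : Matrix (Fin N) (Fin N) ℂ) : rntr X = UnitaryModel.nReTr X := by
  rw [← rntrCLM_eq_rntr, rntrCLM_apply_eq_nReTr]

end Bridge

end Literature.MathematicalPhysics.QuantumFieldTheory.Balaban1983to89.B12Eq439PrintLetters

end
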